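import Literature.IUT.LogThetaLattice.GlobalPacketsLGP
import Literature.IUT.LogThetaLattice.VerticallyCoricLGPBadPackets
import Mathlib.Analysis.Normed.Field.UnitBall
import HarnessLib

/-!
# [IUTchIII] Proposition 3.4 (ii): the output signature `LGPMonoidSignature` is INHABITED at a genuine
# bad-place tensor-packet model (non-vacuity witness, L6 row «NV-L6 LGPMonoidSignature»)

S. Mochizuki, *Inter-universal Teichmüller theory III*, kurims manuscript (May 2020), §3, Proposition 3.4 (ii)
"(Local Logarithmic Gaussian Procession Monoids)" pp. 102–103, with Fig. 3.1 p. 101 (the splitting monoid at the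
label `j` is generated by `q^{j²}`), Proposition 3.1 (ii) p. 93 (the ring homomorphism `log(^α𝓕_v) →
log(^{A,α}𝓕_v)` "tensor with `1`'s"), Proposition 3.2 (ii) p. 99 (`𝓘^ℚ(−)` = the `ℚ`-span of the log-shell
packet) and [IUTchII] Cor. 3.5 (ii) p. 94 (`Ψ_ξ = Ψ^× · ξ^ℕ`). [claim: Mochizuki2012, status: disputed] for every
quoted sentence.

PROOF-ONLY file (abc-iut cell, layer L6, seat abc-iut-w5-d112; L6-lead §F v1.18p «NV-L6 WAVE», w5-d114's
INHABITATION-CENSUS-L6-v3 §A: `LGPMonoidSignature` had ZERO producers). No definition, no instance, no Prop fact: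
the witness is built inside the theorem term.

THE MODEL (GENUINE carrier and monoids, one bad nonarchimedean place). Fix a prime `p`, a `p`-adic coric field
`K = K_v` (any nontrivially normed field with a `ℚ_p`-algebra structure, of characteristic `0` — e.g. a
finite extension of `ℚ_p` with its absolute value; cf. abc-iut-w4-d036's `[Algebra ℚ_[p]]` convention for the packets), an element `q ∈ K` (intended: the `2l`-th root of the `q`-parameter at `v`, [IUTchI] Ex. 3.2
(iv); no norm hypothesis is needed for inhabitation), `2l`, and `l⋇`. Take `𝕍 := {v}` (`Unit`), every place bad.
For the label `j ∈ {1, …, l⋇}` (index `i : Fin l⋇`, `j = i+1`) the ambient ring is abc-iut-L6-t4's REAL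
`(S^±_{j+1}, j)`-tensor packet `log(^{S^±_{j+1},j}𝓕_v) = K_v ⊗_{ℚ_p} (⊗_{β ≠ j} ⊕_{w|p} K_w)`
(`PacketAt ℚ_[p] (fun _ _ => K) (Fin.last j) ()`, `TensorPackets.lean`, all factors `K`), and

* `Ψ_{𝓕_LGP,v}` at `j` := the image under Prop. 3.1 (ii)'s `toPacketAt` of `𝒪^×_{K_v} · q^{j²·ℕ}`
  (`Submonoid.unitSphere K ⊔ powers (q^{j²})`, the shape `Ψ^× · ξ^ℕ` of [IUTchII] Cor. 3.5 (ii));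
* `Ψ^⊥` (splitting, `v` bad) := the image of abc-iut-L6-t2's `splittingMonoidAt K 2l q j = μ_{2l} · q^{j²·ℕ}`
  (`SplittingMonoidValues.lean`) — a submonoid of `Ψ` because `2l`-th roots of unity have norm `1`;
* the Galois-invariant parts := the whole monoids (the model is typed at the `G_v`-invariant level `K_v`;
  p. 103: at bad `v` the invariants are what is used), the unit portion := the image of `𝒪^×_{K_v}`;
* `_∞Ψ` is rendered by `Ψ` itself (no further roots are adjoined inside `K_v`) — a legitimate value of the
  signature's free field `ΨInf`, recorded as a SIMPLIFICATION;
* `𝓘^ℚ` := `⊤`. JUSTIFICATION (kernel, not convenience): at a bad place the `ℚ_p`-span of the packet log-shell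
  IS the whole packet — abc-iut-w4-d036's `shellQSpan_shellPacketAt_eq_top` (`VerticallyCoricLGPBadPackets.lean`,
  p412324; "every pure tensor is a `p`-power multiple of a pure tensor of integers, and `𝒪 ⊆ ℐ`") — so the two
  printed properties of Prop. 3.4 (ii) p. 103 ("is a subset of `𝓘^ℚ(…)`", "acts multiplicatively on `𝓘^ℚ(…)`")
  hold outright at this model.

HONEST LABEL: GENUINE in the carrier (real tensor packet over a `p`-adic field), in the monoids (print's shapes
over landed producers) and in the splitting monoid; SIMPLIFIED in: one place, all tensor factors equal to `K_v`,
`_∞Ψ := Ψ`, `𝓘^ℚ := ⊤` by the cited theorem rather than as `Submodule.span`. Nothing here asserts anything about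
[IUTchIII] Cor. 3.12 or takes a side; a non-vacuity witness certifies «inhabited», never «endorsed».
-/

noncomputable section

namespace Literature.IUT.LogThetaLattice

open Literature.IUT.HodgeArakelov

/-- **`LGPMonoidSignature` is inhabited at the genuine one-bad-place tensor-packet model** described in the
module docstring: `𝕍 = {v}` all bad, ambient rings = the real `(S^±_{j+1}, j)`-tensor packets over the
`p`-adic field `K_v` (abc-iut-L6-t4 `PacketAt`), `Ψ = ι(𝒪^× · q^{j²ℕ})`, `Ψ^⊥ = ι(μ_{2l} · q^{j²ℕ})`
(abc-iut-L6-t2 `splittingMonoidAt`), `𝓘^ℚ = ⊤` (abc-iut-w4-d036 `shellQSpan_shellPacketAt_eq_top`).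
Hypothesis `0 < 2l` only (roots of unity of order dividing `2l` then have norm `1`).
[claim: Mochizuki2012, status: disputed] -/
theorem LGPMonoidSignature.nonempty_model (p : ℕ) [Fact p.Prime] (K : Type) [NontriviallyNormedField K]
    [Algebra ℚ_[p] K] [CharZero K] (lstar twoL : ℕ) (htwoL : 0 < twoL) (q : K) :
    Nonempty (LGPMonoidSignature lstar Unit (fun _ => True)
      (fun (_ : Unit) (i : Fin lstar) =>
        PacketAt ℚ_[p] (fun (_ : Fin ((i : ℕ) + 1 + 1)) (_ : Unit) => K) (Fin.last ((i : ℕ) + 1)) ())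
      (fun _ _ => ⊤)) := by
  -- the ring homomorphism `log(^j𝓕_v) → log(^{S^±_{j+1},j}𝓕_v)` of Prop. 3.1 (ii), as a monoid hom
  let ι : ∀ i : Fin lstar,
      K →* PacketAt ℚ_[p] (fun (_ : Fin ((i : ℕ) + 1 + 1)) (_ : Unit) => K) (Fin.last ((i : ℕ) + 1)) () :=
    fun i => (toPacketAt ℚ_[p] (fun (_ : Fin ((i : ℕ) + 1 + 1)) (_ : Unit) => K) (Fin.last ((i : ℕ) + 1)) ()
      ).toRingHom.toMonoidHom
  -- `𝒪^× · q^{j²ℕ} ⊆ K_v` at the label `j = i+1`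
  let ΨK : Fin lstar → Submonoid K := fun i =>
    Submonoid.unitSphere K ⊔ Submonoid.powers (q ^ ((i : ℕ) + 1) ^ 2)
  -- `μ_{2l} · q^{j²ℕ} ⊆ 𝒪^× · q^{j²ℕ}`: roots of unity have norm one
  have hsplit : ∀ i : Fin lstar, splittingMonoidAt K twoL q ((i : ℕ) + 1) ≤ ΨK i := by
    intro i x hx
    rw [mem_splittingMonoidAt_iff] at hx
    obtain ⟨ζ, hζ, n, rfl⟩ := hx
    refine Submonoid.mul_mem_sup ?_ ⟨n, rfl⟩
    have hζ1 : ‖(ζ : K)‖ = 1 := by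
      rw [mem_rootsOfUnity] at hζ
      have h : ‖(ζ : K)‖ ^ twoL = 1 := by
        rw [← norm_pow, ← Units.val_pow_eq_pow_val, hζ, Units.val_one, norm_one]
      exact (pow_eq_one_iff_of_nonneg (norm_nonneg _) htwoL.ne').mp h
    change (ζ : K) ∈ Metric.sphere (0 : K) 1
    exact mem_sphere_zero_iff_norm.mpr hζ1
  exact ⟨{ Ψ := fun _ i => (ΨK i).map (ι i),
            ΨInf := fun _ i => (ΨK i).map (ι i),
            ΨGal := fun _ i => (ΨK i).map (ι i),
            gal_le := fun _ _ => le_rfl,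
            ΨUnitsGal := fun _ i => (Submonoid.unitSphere K).map (ι i),
            unitsGal_le := fun _ i => Submonoid.monotone_map le_sup_left,
            ΨSplit := fun _ _ i => (splittingMonoidAt K twoL q ((i : ℕ) + 1)).map (ι i),
            split_le := fun _ _ i => Submonoid.monotone_map (hsplit i),
            bad_gal_subset := fun _ _ _ => by simp,
            bad_gal_acts := fun _ _ _ _ _ _ _ => Submodule.mem_top,
            unitsGal_subset := fun _ _ => by simp,
            unitsGal_acts := fun _ _ _ _ _ _ => Submodule.mem_top }⟩

end Literature.IUT.LogThetaLattice

end
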